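import Mathlib
import HarnessLib

/-!
# Congruence-restricted bilinear forms, one class at a time (Schur's test per class pair)

Topic `Literature/NumberTheory/Sieve`. Everything in this file is PROVED (theorems only) and
elementary; it is the one-modulus bookkeeping of the "class-aware Cauchy–Schwarz + Schur" step of
dispersion-type arguments (Schur's test / duality: Iwaniec–Kowalski §7.1; bilinear forms over
residue classes: Harman, *Prime-detecting sieves*, §14.2), stated for an arbitrary weight
`f : ℕ → ℝ` with `|f| ≤ 1` (in applications `f(n) = λ(n + h)`), coefficient sequences `α, β`,
a modulus `q ≥ 1` and ONE residue `w` coprime to `q`.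

* `sum_ite_modEq_eq_sum_range` — the class split
  `∑_m ∑_k 1[mk ≡ w (q)] F(m,k) = ∑_{v < q} ∑_{m : mv ≡ w} ∑_{k ≡ v} F(m,k)`;
* `sum_range_sum_filter_le` — classes that are pairwise disjoint carry at most the full mass;
* `card_filter_Ioc_modEq_le` — `#{k ∈ (K, 2K] : k ≡ v (q)} ≤ K/q + 1`;
* `row_sum_le`, `abs_classPair_le`, `abs_classSum_le` — with `(w, q) = 1`: the row sums of the
  class Gram matrix `G_v(m, m') = ∑_{k ∈ T_v} f(mk) f(m'k)` on `S_v = {m : mv ≡ w}` are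
  `≤ #T_v + RS` whenever `RS` dominates the off-diagonal row sums (for `m ∈ S_v` the
  off-diagonal part of the row runs over `{m' ≡ m (q), m' ≠ m}`, because `S_v = {m' ≡ m (q)}`
  by cancelling the unit `v`); a Schur-type bound for bilinear forms (taken as the HYPOTHESIS
  `hS` — `(∑∑ α β f)² ≤ ‖β‖² ‖α‖² · max row sum of |G|`, Iwaniec–Kowalski §7.1) in each class
  pair and Cauchy–Schwarz over `v` give
  `|∑_m ∑_k 1[mk ≡ w] α_m β_k f(mk)| ≤ (K/q + 1 + RS)^{1/2} ‖α‖₂ ‖β‖₂`;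
* `sum_Icc_one_div_sqrt_le`, `sum_Icc_sqrt_diag_le` — summing the last bound over the moduli
  `q ≤ Q`: `∑_q (K/q + 1 + RS_q)^{1/2} ≤ 2√K√Q + Q + (∑_q q RS_q)^{1/2} (∑_q 1/q)^{1/2}`.

Deliberately NOT here: Schur's test itself (a hypothesis), and any arithmetic input on the
off-diagonal row sums `RS_q` (in the application: a row-sum form of Chowla's conjecture).

## References

* H. Iwaniec, E. Kowalski, *Analytic Number Theory*, AMS 2004, §7.1 (duality, Schur's test)
  [IwaniecKowalski2004].
* G. Harman, *Prime-detecting sieves*, Princeton 2007, §14.2 [Harman2007].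
-/

noncomputable section

open Finset Real

namespace Literature.NumberTheory.Sieve.ClassSchurBilinear

/-! ### Class splitting -/

/-- **Class split of a congruence-restricted bilinear sum**: for `q ≥ 1`,
`∑_{m ∈ sM} ∑_{k ∈ sK} 1[mk ≡ w (q)] F(m,k)
  = ∑_{v < q} ∑_{m ∈ sM, mv ≡ w (q)} ∑_{k ∈ sK, k ≡ v (q)} F(m,k)`
(split by the class `v` of `k`; on it `mk ≡ mv`). [folklore] -/
theorem sum_ite_modEq_eq_sum_range {q : ℕ} (hq : 0 < q) (w : ℕ) (sM sK : Finset ℕ)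
    (F : ℕ → ℕ → ℝ) :
    ∑ m ∈ sM, ∑ k ∈ sK, (if m * k ≡ w [MOD q] then F m k else 0) =
      ∑ v ∈ range q, ∑ m ∈ sM.filter (fun m : ℕ => m * v ≡ w [MOD q]),
        ∑ k ∈ sK.filter (fun k : ℕ => k ≡ v [MOD q]), F m k := by
  -- insert the class of `k`
  have hins : ∀ m k, (if m * k ≡ w [MOD q] then F m k else 0) =
      ∑ v ∈ range q, if k % q = v then (if m * k ≡ w [MOD q] then F m k else 0) else 0 := by
    intro m k
    rw [sum_ite_eq, if_pos (mem_range.2 (Nat.mod_lt k hq))]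
  rw [show (∑ m ∈ sM, ∑ k ∈ sK, if m * k ≡ w [MOD q] then F m k else 0) =
      ∑ m ∈ sM, ∑ k ∈ sK, ∑ v ∈ range q,
        (if k % q = v then (if m * k ≡ w [MOD q] then F m k else 0) else 0) from
    sum_congr rfl fun m _ => sum_congr rfl fun k _ => hins m k]
  calc ∑ m ∈ sM, ∑ k ∈ sK, ∑ v ∈ range q,
        (if k % q = v then (if m * k ≡ w [MOD q] then F m k else 0) else 0)
      = ∑ m ∈ sM, ∑ v ∈ range q, ∑ k ∈ sK,
          (if k % q = v then (if m * k ≡ w [MOD q] then F m k else 0) else 0) :=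
        sum_congr rfl fun m _ => sum_comm
    _ = ∑ v ∈ range q, ∑ m ∈ sM, ∑ k ∈ sK,
          (if k % q = v then (if m * k ≡ w [MOD q] then F m k else 0) else 0) := sum_comm
    _ = _ := by
        refine sum_congr rfl fun v hv => ?_
        have hvq : v < q := mem_range.1 hv
        have hclass : ∀ k, k % q = v ↔ k ≡ v [MOD q] := fun k => by
          rw [Nat.ModEq, Nat.mod_eq_of_lt hvq]
        rw [sum_filter]
        refine sum_congr rfl fun m _ => ?_
        rw [sum_filter]
        by_cases hmv : m * v ≡ w [MOD q]
        · rw [if_pos hmv]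
          refine sum_congr rfl fun k _ => ?_
          by_cases hk : k % q = v
          · have hk' : k ≡ v [MOD q] := (hclass k).1 hk
            rw [if_pos hk, if_pos (hk'.mul_left m |>.trans hmv), if_pos hk']
          · rw [if_neg hk, if_neg (fun h => hk ((hclass k).2 h))]
        · rw [if_neg hmv]
          refine sum_eq_zero fun k _ => ?_
          by_cases hk : k % q = v
          · have hk' : k ≡ v [MOD q] := (hclass k).1 hk
            rw [if_pos hk, if_neg (fun h => hmv ((hk'.mul_left m).symm.trans h))]
          · rw [if_neg hk]

/-- **Disjoint classes carry at most the full mass**: if for each `m ∈ s` at most one `v < q`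
satisfies `P v m`, then `∑_{v < q} ∑_{m ∈ s, P v m} g(m) ≤ ∑_{m ∈ s} g(m)` for `g ≥ 0`.
[folklore] -/
theorem sum_range_sum_filter_le {q : ℕ} (s : Finset ℕ) {g : ℕ → ℝ} (hg : ∀ m, 0 ≤ g m)
    (P : ℕ → ℕ → Prop) [∀ v, DecidablePred (P v)]
    (hP : ∀ m ∈ s, ∀ v ∈ range q, ∀ v' ∈ range q, P v m → P v' m → v = v') :
    ∑ v ∈ range q, ∑ m ∈ s.filter (P v), g m ≤ ∑ m ∈ s, g m := by
  calc ∑ v ∈ range q, ∑ m ∈ s.filter (P v), g m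
      = ∑ v ∈ range q, ∑ m ∈ s, (if P v m then g m else 0) :=
        sum_congr rfl fun v _ => sum_filter _ _
    _ = ∑ m ∈ s, ∑ v ∈ range q, (if P v m then g m else 0) := sum_comm
    _ ≤ ∑ m ∈ s, g m := sum_le_sum fun m hm => ?_
  have hs : ∑ v ∈ range q, (if P v m then g m else 0) =
      ∑ _v ∈ (range q).filter (fun v => P v m), g m := (sum_filter _ _).symm
  have hc : #((range q).filter (fun v => P v m)) ≤ 1 :=
    card_le_one.2 fun v hv v' hv' => hP m hm v (mem_filter.1 hv).1 v' (mem_filter.1 hv').1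
      (mem_filter.1 hv).2 (mem_filter.1 hv').2
  rw [hs, sum_const, nsmul_eq_mul]
  calc (#((range q).filter (fun v => P v m)) : ℝ) * g m ≤ 1 * g m :=
        mul_le_mul_of_nonneg_right (by exact_mod_cast hc) (hg m)
    _ = g m := one_mul _

/-- **One class in a dyadic interval**: `#{k ∈ (K, 2K] : k ≡ v (q)} ≤ K/q + 1`
(`k ↦ (k − K − 1)/q` is injective on the class, with values `≤ (K − 1)/q`; also true, trivially,
with Lean's conventions at `q = 0`). [folklore] -/
theorem card_filter_Ioc_modEq_le (q K v : ℕ) :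
    (#((Ioc K (2 * K)).filter (fun k : ℕ => k ≡ v [MOD q])) : ℝ) ≤ (K : ℝ) / q + 1 := by
  have hcard : #((Ioc K (2 * K)).filter (fun k : ℕ => k ≡ v [MOD q])) ≤ K / q + 1 := by
    rw [← card_range (K / q + 1)]
    refine card_le_card_of_injOn (fun k => (k - (K + 1)) / q) (fun k hk => ?_)
      (fun k₁ hk₁ k₂ hk₂ h => ?_)
    · have hk' := mem_Ioc.1 (mem_filter.1 (mem_coe.1 hk)).1
      rw [mem_coe, mem_range]
      exact lt_of_le_of_lt (Nat.div_le_div_right (by omega : k - (K + 1) ≤ K))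
        (Nat.lt_succ_self _)
    · have h₁ := mem_filter.1 (mem_coe.1 hk₁)
      have h₂ := mem_filter.1 (mem_coe.1 hk₂)
      have hK₁ : K + 1 ≤ k₁ := (mem_Ioc.1 h₁.1).1
      have hK₂ : K + 1 ≤ k₂ := (mem_Ioc.1 h₂.1).1
      have hmod : (k₁ - (K + 1)) % q = (k₂ - (K + 1)) % q := by
        have h12 : k₁ - (K + 1) ≡ k₂ - (K + 1) [MOD q] := by
          refine Nat.ModEq.add_right_cancel' (K + 1) ?_
          rw [Nat.sub_add_cancel hK₁, Nat.sub_add_cancel hK₂]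
          exact h₁.2.trans h₂.2.symm
        exact h12
      dsimp only at h
      have hsub : k₁ - (K + 1) = k₂ - (K + 1) := by
        rw [← Nat.div_add_mod (k₁ - (K + 1)) q, ← Nat.div_add_mod (k₂ - (K + 1)) q, h, hmod]
      omega
  calc (#((Ioc K (2 * K)).filter (fun k : ℕ => k ≡ v [MOD q])) : ℝ)
      ≤ ((K / q + 1 : ℕ) : ℝ) := by exact_mod_cast hcard
    _ = ((K / q : ℕ) : ℝ) + 1 := by push_cast; ring
    _ ≤ (K : ℝ) / q + 1 := by
        have : ((K / q : ℕ) : ℝ) ≤ (K : ℝ) / q := Nat.cast_div_le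
        linarith

/-! ### One modulus: rows of the class Gram matrices, Schur per class, Cauchy–Schwarz -/

/-- **Row sums of a class Gram matrix.**  For `(w, q) = 1`, `m` in the class box
`S_v = {m ∈ sM : mv ≡ w (q)}` and `|f| ≤ 1`:
`∑_{m' ∈ S_v} |∑_{k ∈ T} f(mk) f(m'k)| ≤ #T + RS`, where `RS` bounds the OFF-diagonal row
sum `∑_{m' ∈ sM, m' ≡ m (q), m' ≠ m} |∑_{k ∈ T} f(mk) f(m'k)|` — indeed
`S_v ∖ {m} = {m' ≡ m (q), m' ≠ m}` since `v` is a unit modulo `q`. [folklore] -/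
theorem row_sum_le {f : ℕ → ℝ} (hf : ∀ n, |f n| ≤ 1) {q w : ℕ} (hw : Nat.Coprime w q)
    (sM T : Finset ℕ) (v : ℕ) {RS : ℝ}
    (hRS : ∀ m₀ ∈ sM,
      ∑ m' ∈ sM.filter (fun m' : ℕ => m' ≡ m₀ [MOD q] ∧ m' ≠ m₀),
        |∑ k ∈ T, f (m₀ * k) * f (m' * k)| ≤ RS)
    {m : ℕ} (hm : m ∈ sM.filter (fun m : ℕ => m * v ≡ w [MOD q])) :
    ∑ m' ∈ sM.filter (fun m : ℕ => m * v ≡ w [MOD q]), |∑ k ∈ T, f (m * k) * f (m' * k)|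
      ≤ #T + RS := by
  have hmS := mem_filter.1 hm
  have hcop : Nat.Coprime q v :=
    (Nat.coprime_mul_iff_left.1 (hmS.2.gcd_eq.trans (Nat.Coprime.gcd_eq_one hw))).2.symm
  have herase : (sM.filter (fun m : ℕ => m * v ≡ w [MOD q])).erase m =
      sM.filter (fun m' : ℕ => m' ≡ m [MOD q] ∧ m' ≠ m) := by
    ext m'
    simp only [mem_erase, mem_filter]
    constructor
    · rintro ⟨hne, hm', hm'v⟩
      exact ⟨hm', Nat.ModEq.cancel_right_of_coprime hcop (hm'v.trans hmS.2.symm), hne⟩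
    · rintro ⟨hm', hmm', hne⟩
      exact ⟨hne, hm', (hmm'.mul_right v).trans hmS.2⟩
  rw [← add_sum_erase _ _ hm, herase]
  refine add_le_add ?_ (hRS m hmS.1)
  calc |∑ k ∈ T, f (m * k) * f (m * k)| ≤ ∑ k ∈ T, |f (m * k) * f (m * k)| :=
        abs_sum_le_sum_abs _ _
    _ ≤ ∑ _k ∈ T, (1 : ℝ) := sum_le_sum fun k _ => by
        rw [abs_mul]
        exact mul_le_one₀ (hf _) (abs_nonneg _) (hf _)
    _ = #T := by simp

/-- **One class pair, by Schur's test.**  With `S_v = {m ∈ (M,2M] : mv ≡ w (q)}`,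
`T_v = {k ∈ (K,2K] : k ≡ v (q)}`, `(w,q) = 1`, `|f| ≤ 1`, and `RS` dominating the off-diagonal
row sums of the class Gram matrices:
`|∑_{m ∈ S_v} ∑_{k ∈ T_v} α_m β_k f(mk)| ≤ (K/q + 1 + RS)^{1/2} ‖α|S_v‖₂ ‖β|T_v‖₂`
(the Schur-type bound is the hypothesis `hS`; rows by `row_sum_le`, `#T_v ≤ K/q + 1`).
[folklore] -/
theorem abs_classPair_le
    (hS : ∀ (S T : Finset ℕ) (α β : ℕ → ℝ) (f : ℕ → ℕ → ℝ) (R : ℝ),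
      (∀ m ∈ S, ∑ m' ∈ S, |∑ k ∈ T, f m k * f m' k| ≤ R) →
        (∑ m ∈ S, ∑ k ∈ T, α m * β k * f m k) ^ 2 ≤
          (∑ k ∈ T, β k ^ 2) * (∑ m ∈ S, α m ^ 2) * R)
    {f : ℕ → ℝ} (hf : ∀ n, |f n| ≤ 1) {q w : ℕ} (hw : Nat.Coprime w q)
    (M K : ℕ) (α β : ℕ → ℝ) (v : ℕ) {RS : ℝ}
    (hRS : ∀ m₀ ∈ Ioc M (2 * M),
      ∑ m' ∈ (Ioc M (2 * M)).filter (fun m' : ℕ => m' ≡ m₀ [MOD q] ∧ m' ≠ m₀),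
        |∑ k ∈ (Ioc K (2 * K)).filter (fun k : ℕ => k ≡ v [MOD q]), f (m₀ * k) * f (m' * k)|
          ≤ RS) :
    |∑ m ∈ (Ioc M (2 * M)).filter (fun m : ℕ => m * v ≡ w [MOD q]),
        ∑ k ∈ (Ioc K (2 * K)).filter (fun k : ℕ => k ≡ v [MOD q]), α m * β k * f (m * k)|
      ≤ Real.sqrt ((K : ℝ) / q + 1 + RS) *
        (Real.sqrt (∑ m ∈ (Ioc M (2 * M)).filter (fun m : ℕ => m * v ≡ w [MOD q]), α m ^ 2)
          * Real.sqrt (∑ k ∈ (Ioc K (2 * K)).filter (fun k : ℕ => k ≡ v [MOD q]), β k ^ 2)) := by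
  set S := (Ioc M (2 * M)).filter (fun m : ℕ => m * v ≡ w [MOD q]) with hSdef
  set T := (Ioc K (2 * K)).filter (fun k : ℕ => k ≡ v [MOD q]) with hTdef
  have hrow : ∀ m ∈ S, ∑ m' ∈ S, |∑ k ∈ T, f (m * k) * f (m' * k)| ≤ #T + RS :=
    fun m hm => row_sum_le hf hw (Ioc M (2 * M)) T v hRS hm
  have hsq : (∑ m ∈ S, ∑ k ∈ T, α m * β k * f (m * k)) ^ 2 ≤
      (∑ k ∈ T, β k ^ 2) * (∑ m ∈ S, α m ^ 2) * (#T + RS) :=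
    hS S T α β (fun m k => f (m * k)) _ hrow
  have hTcard : (#T : ℝ) + RS ≤ (K : ℝ) / q + 1 + RS := by
    have := card_filter_Ioc_modEq_le q K v
    linarith
  have hb0 : 0 ≤ ∑ k ∈ T, β k ^ 2 := sum_nonneg fun _ _ => sq_nonneg _
  have ha0 : 0 ≤ ∑ m ∈ S, α m ^ 2 := sum_nonneg fun _ _ => sq_nonneg _
  have hab : 0 ≤ (∑ k ∈ T, β k ^ 2) * (∑ m ∈ S, α m ^ 2) := mul_nonneg hb0 ha0
  calc |∑ m ∈ S, ∑ k ∈ T, α m * β k * f (m * k)|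
      ≤ Real.sqrt ((∑ k ∈ T, β k ^ 2) * (∑ m ∈ S, α m ^ 2) * ((K : ℝ) / q + 1 + RS)) :=
        Real.abs_le_sqrt (hsq.trans (mul_le_mul_of_nonneg_left hTcard hab))
    _ = _ := by
        rw [Real.sqrt_mul hab, Real.sqrt_mul hb0]
        ring

/-- **One modulus** (`q ≥ 1`, `(w, q) = 1`, `|f| ≤ 1`, Schur's test `hS` as a hypothesis): if
`RS` dominates every off-diagonal row sum `∑_{m' ≡ m₀, m' ≠ m₀} |∑_{k ≡ v} f(m₀k) f(m'k)|`
(`v < q`, `m₀ ∈ (M, 2M]`), then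
`|∑_{m ∈ (M,2M]} ∑_{k ∈ (K,2K]} 1[mk ≡ w (q)] α_m β_k f(mk)| ≤ (K/q + 1 + RS)^{1/2} ‖α‖₂ ‖β‖₂`:
class split, `abs_classPair_le` in each class pair, Cauchy–Schwarz over `v`, and the classes
`S_v` (resp. `T_v`) are pairwise disjoint. [folklore] -/
theorem abs_classSum_le
    (hS : ∀ (S T : Finset ℕ) (α β : ℕ → ℝ) (f : ℕ → ℕ → ℝ) (R : ℝ),
      (∀ m ∈ S, ∑ m' ∈ S, |∑ k ∈ T, f m k * f m' k| ≤ R) →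
        (∑ m ∈ S, ∑ k ∈ T, α m * β k * f m k) ^ 2 ≤
          (∑ k ∈ T, β k ^ 2) * (∑ m ∈ S, α m ^ 2) * R)
    {f : ℕ → ℝ} (hf : ∀ n, |f n| ≤ 1) {q : ℕ} (hq : 0 < q) {w : ℕ} (hw : Nat.Coprime w q)
    (M K : ℕ) (α β : ℕ → ℝ) {RS : ℝ}
    (hRS : ∀ v ∈ range q, ∀ m₀ ∈ Ioc M (2 * M),
      ∑ m' ∈ (Ioc M (2 * M)).filter (fun m' : ℕ => m' ≡ m₀ [MOD q] ∧ m' ≠ m₀),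
        |∑ k ∈ (Ioc K (2 * K)).filter (fun k : ℕ => k ≡ v [MOD q]), f (m₀ * k) * f (m' * k)|
          ≤ RS) :
    |∑ m ∈ Ioc M (2 * M), ∑ k ∈ Ioc K (2 * K),
        (if m * k ≡ w [MOD q] then α m * β k * f (m * k) else 0)| ≤
      Real.sqrt ((K : ℝ) / q + 1 + RS) * Real.sqrt (∑ m ∈ Ioc M (2 * M), α m ^ 2) *
        Real.sqrt (∑ k ∈ Ioc K (2 * K), β k ^ 2) := by
  have hsplit := sum_ite_modEq_eq_sum_range hq w (Ioc M (2 * M)) (Ioc K (2 * K))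
    (fun m k => α m * β k * f (m * k))
  beta_reduce at hsplit
  rw [hsplit]
  -- abbreviations (only for this proof's readability)
  set S : ℕ → Finset ℕ := fun v => (Ioc M (2 * M)).filter (fun m : ℕ => m * v ≡ w [MOD q])
    with hSdef
  set T : ℕ → Finset ℕ := fun v => (Ioc K (2 * K)).filter (fun k : ℕ => k ≡ v [MOD q])
    with hTdef
  have ha0 : ∀ v, 0 ≤ ∑ m ∈ S v, α m ^ 2 := fun v => sum_nonneg fun _ _ => sq_nonneg _
  have hb0 : ∀ v, 0 ≤ ∑ k ∈ T v, β k ^ 2 := fun v => sum_nonneg fun _ _ => sq_nonneg _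
  -- the classes are pairwise disjoint
  have hSdisj : ∑ v ∈ range q, ∑ m ∈ S v, α m ^ 2 ≤ ∑ m ∈ Ioc M (2 * M), α m ^ 2 := by
    refine sum_range_sum_filter_le (Ioc M (2 * M)) (fun m => sq_nonneg (α m))
      (fun v m => m * v ≡ w [MOD q]) fun m _ v hv v' hv' h1 h2 => ?_
    have hmq : Nat.Coprime q m :=
      (Nat.coprime_mul_iff_left.1 (h1.gcd_eq.trans (Nat.Coprime.gcd_eq_one hw))).1.symm
    exact Nat.ModEq.eq_of_lt_of_lt (Nat.ModEq.cancel_left_of_coprime hmq (h1.trans h2.symm))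
      (mem_range.1 hv) (mem_range.1 hv')
  have hTdisj : ∑ v ∈ range q, ∑ k ∈ T v, β k ^ 2 ≤ ∑ k ∈ Ioc K (2 * K), β k ^ 2 :=
    sum_range_sum_filter_le (Ioc K (2 * K)) (fun k => sq_nonneg (β k))
      (fun v k => k ≡ v [MOD q]) fun k _ v hv v' hv' h1 h2 =>
        Nat.ModEq.eq_of_lt_of_lt (h1.symm.trans h2) (mem_range.1 hv) (mem_range.1 hv')
  calc |∑ v ∈ range q, ∑ m ∈ S v, ∑ k ∈ T v, α m * β k * f (m * k)|
      ≤ ∑ v ∈ range q, |∑ m ∈ S v, ∑ k ∈ T v, α m * β k * f (m * k)| :=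
        abs_sum_le_sum_abs _ _
    _ ≤ ∑ v ∈ range q, Real.sqrt ((K : ℝ) / q + 1 + RS) *
          (Real.sqrt (∑ m ∈ S v, α m ^ 2) * Real.sqrt (∑ k ∈ T v, β k ^ 2)) :=
        sum_le_sum fun v hv => abs_classPair_le hS hf hw M K α β v (hRS v hv)
    _ = Real.sqrt ((K : ℝ) / q + 1 + RS) *
          ∑ v ∈ range q, Real.sqrt (∑ m ∈ S v, α m ^ 2) * Real.sqrt (∑ k ∈ T v, β k ^ 2) := by
        rw [mul_sum]
    _ ≤ Real.sqrt ((K : ℝ) / q + 1 + RS) *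
          (Real.sqrt (∑ v ∈ range q, ∑ m ∈ S v, α m ^ 2) *
            Real.sqrt (∑ v ∈ range q, ∑ k ∈ T v, β k ^ 2)) :=
        mul_le_mul_of_nonneg_left (Real.sum_sqrt_mul_sqrt_le _ ha0 hb0) (Real.sqrt_nonneg _)
    _ ≤ Real.sqrt ((K : ℝ) / q + 1 + RS) * (Real.sqrt (∑ m ∈ Ioc M (2 * M), α m ^ 2) *
          Real.sqrt (∑ k ∈ Ioc K (2 * K), β k ^ 2)) := by
        gcongr
    _ = _ := by ring

/-! ### The sum over the moduli -/

/-- `∑_{q=1}^{Q} 1/√q ≤ 2√Q` (induction: `1/√(n+1) ≤ 2(√(n+1) − √n)`). [folklore] -/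
theorem sum_Icc_one_div_sqrt_le (Q : ℕ) :
    ∑ q ∈ Icc 1 Q, 1 / Real.sqrt q ≤ 2 * Real.sqrt Q := by
  induction Q with
  | zero => simp
  | succ n ih =>
    rw [sum_Icc_succ_top (Nat.le_add_left 1 n) (fun q : ℕ => 1 / Real.sqrt q)]
    have hs : 0 < Real.sqrt ((n + 1 : ℕ) : ℝ) := Real.sqrt_pos.2 (by positivity)
    have key : 1 / Real.sqrt ((n + 1 : ℕ) : ℝ) ≤
        2 * Real.sqrt ((n + 1 : ℕ) : ℝ) - 2 * Real.sqrt (n : ℝ) := by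
      rw [div_le_iff₀ hs]
      have h1 : Real.sqrt ((n + 1 : ℕ) : ℝ) ^ 2 = n + 1 := by
        rw [Real.sq_sqrt (by positivity)]; push_cast; ring
      have h2 : Real.sqrt (n : ℝ) ^ 2 = n := Real.sq_sqrt (Nat.cast_nonneg n)
      nlinarith [sq_nonneg (Real.sqrt ((n + 1 : ℕ) : ℝ) - Real.sqrt (n : ℝ))]
    linarith

/-- **The diagonal and off-diagonal sums over the moduli**: for `K ≥ 0`, `RS ≥ 0`,
`∑_{q=1}^{Q} (K/q + 1 + RS_q)^{1/2} ≤ 2√K√Q + Q + (∑_q q·RS_q)^{1/2} (∑_q 1/q)^{1/2}`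
(`√(a+b+c) ≤ √a + √b + √c`, `∑ 1/√q ≤ 2√Q`, Cauchy–Schwarz). [folklore] -/
theorem sum_Icc_sqrt_diag_le (Q : ℕ) {K : ℝ} (hK : 0 ≤ K) {RS : ℕ → ℝ}
    (hRS : ∀ q, 0 ≤ RS q) :
    ∑ q ∈ Icc 1 Q, Real.sqrt (K / q + 1 + RS q) ≤
      2 * Real.sqrt K * Real.sqrt Q + Q +
        Real.sqrt (∑ q ∈ Icc 1 Q, (q : ℝ) * RS q) *
          Real.sqrt (∑ q ∈ Icc 1 Q, (1 : ℝ) / q) := by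
  have hsqrt : ∀ a b : ℝ, 0 ≤ a → 0 ≤ b → Real.sqrt (a + b) ≤ Real.sqrt a + Real.sqrt b := by
    intro a b ha hb
    rw [Real.sqrt_le_left (by positivity)]
    nlinarith [Real.sq_sqrt ha, Real.sq_sqrt hb, Real.sqrt_nonneg a, Real.sqrt_nonneg b,
      mul_nonneg (Real.sqrt_nonneg a) (Real.sqrt_nonneg b)]
  have hterm : ∀ q ∈ Icc 1 Q, Real.sqrt (K / q + 1 + RS q) ≤
      Real.sqrt K * (1 / Real.sqrt q) + 1 +
        Real.sqrt ((q : ℝ) * RS q) * Real.sqrt ((1 : ℝ) / q) := by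
    intro q hq
    have hq1 : (1 : ℝ) ≤ q := by exact_mod_cast (mem_Icc.1 hq).1
    have hq0 : (0 : ℝ) < q := by linarith
    have hlast : Real.sqrt ((q : ℝ) * RS q) * Real.sqrt ((1 : ℝ) / q) = Real.sqrt (RS q) := by
      rw [← Real.sqrt_mul' _ (by positivity : (0 : ℝ) ≤ 1 / q)]
      congr 1
      field_simp
    calc Real.sqrt (K / q + 1 + RS q) ≤ Real.sqrt (K / q + 1) + Real.sqrt (RS q) :=
          hsqrt _ _ (by positivity) (hRS q)
      _ ≤ Real.sqrt (K / q) + Real.sqrt 1 + Real.sqrt (RS q) := by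
          have := hsqrt (K / q) 1 (by positivity) zero_le_one
          linarith
      _ = _ := by rw [Real.sqrt_one, Real.sqrt_div hK, hlast, div_eq_mul_one_div]
  calc ∑ q ∈ Icc 1 Q, Real.sqrt (K / q + 1 + RS q)
      ≤ ∑ q ∈ Icc 1 Q, (Real.sqrt K * (1 / Real.sqrt q) + 1 +
          Real.sqrt ((q : ℝ) * RS q) * Real.sqrt ((1 : ℝ) / q)) := sum_le_sum hterm
    _ = Real.sqrt K * ∑ q ∈ Icc 1 Q, 1 / Real.sqrt q + Q +
          ∑ q ∈ Icc 1 Q, Real.sqrt ((q : ℝ) * RS q) * Real.sqrt ((1 : ℝ) / q) := by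
        rw [sum_add_distrib, sum_add_distrib, mul_sum, sum_const, Nat.card_Icc,
          Nat.add_sub_cancel, nsmul_eq_mul, mul_one]
    _ ≤ Real.sqrt K * (2 * Real.sqrt Q) + Q +
          Real.sqrt (∑ q ∈ Icc 1 Q, (q : ℝ) * RS q) *
            Real.sqrt (∑ q ∈ Icc 1 Q, (1 : ℝ) / q) := by
        gcongr
        · exact sum_Icc_one_div_sqrt_le Q
        · exact Real.sum_sqrt_mul_sqrt_le _ (fun q => mul_nonneg (Nat.cast_nonneg q) (hRS q))
            (fun q => by positivity)
    _ = _ := by ring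

end Literature.NumberTheory.Sieve.ClassSchurBilinear

end
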